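import Mathlib
import HarnessLib
import Summits.Langlands.Langlands.Theorems.TriangulineChamberLiftB2CrysSplitPCompletion
import Summits.Langlands.Langlands.Theorems.NonParallelVoidEmptyWeightCoreStubSplitPrime
import Literature.NumberTheory.PAdicHodge.FontaineDpst

/-!
# S1 of line `local_clause_cut` under `FontaineDatumExists` (crux `EmptyWeightCore`, stmt-Langlands-17008)

The registered stub `stub_pinnedCrystallineDetLocal` of the crux `NonParallelVoid.EmptyWeightCore`
(line `local_clause_cut`) — "for the PINNED Fontaine datum `D_v = fontainePstAdicCompletion v p hv` of a
place `v ∣ p` of a quadratic field in which `p` splits, a `D_v`-crystalline `ρ_v` with labelled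
Hodge–Tate weights `{a, b}` has `det ρ_v = ε^{-(a+b)}` on the local inertia group `I_{F_v}`" — is
clause (F12) `crystallineDetOnInertia` of the pin (`FontaineDatumExists.pinnedCrystallineDetOnInertia`,
`CrystallineDetOnInertia.det_eq_of_labelledHodgeTateWeights_eq_pair`) at a DEGREE-ONE completion
(`ℚ_p → F_v` onto at a split prime: `stub_splitPrime` + `algebraMap_adicCompletion_surjective_of_split`,
the `ℚ_p`-structure of the datum being the canonical one UNCONDITIONALLY,
`fontainePstAdicCompletion_algebra_eq_adicCompletionPadicAlgebra`).

It is proved here UNDER the T0 named fact `Literature.NumberTheory.PAdicHodge.FontaineDatumExists`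
(Fontaine's construction of `(B_dR, WD ∘ D_pst)`; every clause of the pin is predicated of THE datum only
under it, `fontainePst` being Hilbert's `ε`).  It is NOT provable without it: a datum on `B_dR` with the
canonical `ℚ_p`-structure whose Weil–Deligne relation declares every de Rham `ρ` "crystalline" satisfies
the five structure axioms of `PstWeilDeligneData` and violates the statement (a de Rham `ρ` whose
determinant has a non-trivial finite tame part on inertia).  Hence the crux closes CONDITIONALLY on
`FontaineDatumExists` through this file (helper `--supports stmt-Langlands-17008`).
-/

-- project-wide option (lakefile weak.linter.dupNamespace); `Summit.Langlands.Langlands` is mandated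
set_option linter.dupNamespace false

noncomputable section

namespace Summit.Langlands.Langlands.Cruxes.EmptyWeightCore.LocalClauseCut

open Literature.NumberTheory.GaloisRepresentations Literature.NumberTheory.PAdicHodge
open Field IsDedekindDomain NumberField

/-- **S1 under Fontaine's existence theorem.**  Under `FontaineDatumExists`, for `F` a quadratic field,
`p` a prime with two distinct places of `F` above it, `v ∣ p`, `ρ : Γ_F → GL₂(ℚ̄_p)` with `ρ|Γ_{F_v}`
crystalline for THE pinned datum `D_v` and `HT_τ(ρ|Γ_{F_v}) = {a, b}`, one has
`det ρ_v(σ) = ε_{F_v}(σ)^{-(a+b)}` for every `σ ∈ I_{F_v}` — verbatim the registered stub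
`stub_pinnedCrystallineDetLocal`, from clause (F12) of the pin at a degree-one completion.
[cite: BrinonConrad2009, Prop. 8.3.4 and Prop. 9.1.11] [cite: Conrad2011LiftingGlobal, Appendix B, Prop. B.4] -/
theorem stub_pinnedCrystallineDetLocal_of_fontaineDatumExists (hFD : FontaineDatumExists) :
    ∀ (F : Type) [Field F] [NumberField F] [Algebra.IsQuadraticExtension ℚ F] (p : ℕ) [Fact p.Prime]
      (ρ : Literature.NumberTheory.GaloisRepresentations.FramedGaloisRep F (PadicAlgCl p) 2),
      (∃ v w : IsDedekindDomain.HeightOneSpectrum (NumberField.RingOfIntegers F), v ≠ w ∧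
          ((p : ℕ) : NumberField.RingOfIntegers F) ∈ v.asIdeal ∧
          ((p : ℕ) : NumberField.RingOfIntegers F) ∈ w.asIdeal) →
      ∀ (v : IsDedekindDomain.HeightOneSpectrum (NumberField.RingOfIntegers F))
        (hv : ((p : ℕ) : NumberField.RingOfIntegers F) ∈ v.asIdeal),
        (Literature.NumberTheory.PAdicHodge.fontainePstAdicCompletion v p hv).IsCrystallineFramed
            (ρ.toLocal v) →
        letI := (Literature.NumberTheory.PAdicHodge.fontainePstAdicCompletion v p hv).algebra
        ∀ (τ : v.adicCompletion F →ₐ[ℚ_[p]] PadicAlgCl p) (a b : ℤ),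
          ρ.labelledHodgeTateWeightsAt v
              (Literature.NumberTheory.PAdicHodge.fontainePstAdicCompletion v p hv).algebra
              (Literature.NumberTheory.PAdicHodge.fontainePstAdicCompletion v p hv).𝔅 τ.toRingHom =
            {a, b} →
          ∀ σ ∈ Literature.NumberTheory.GaloisRepresentations.absInertia (v.adicCompletion F),
            ((ρ.toLocal v) σ).val.det =
              algebraMap ℚ_[p] (PadicAlgCl p)
                ((((Literature.NumberTheory.GaloisRepresentations.GaloisRep.cyclotomicCharacter
                      (v.adicCompletion F) p σ : ℤ_[p]ˣ) : ℤ_[p]) : ℚ_[p]) ^ (-(a + b))) := by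
  intro F _ _ _ p _ ρ hsplit v hv hcrys τ a b hab σ hσ
  -- clause (F12) of the pin at `v`
  have hF12 := hFD.pinnedCrystallineDetOnInertia F p v hv
  -- `ℚ_p → F_v` is onto (split prime; the datum's `ℚ_p`-structure is the canonical one)
  have hsurj : Function.Surjective
      (@algebraMap ℚ_[p] (v.adicCompletion F) _ _ (fontainePstAdicCompletion v p hv).algebra) := by
    rw [fontainePstAdicCompletion_algebra_eq_adicCompletionPadicAlgebra v p hv]
    exact Summit.Langlands.Langlands.Theorems.LiftB2CrysSplitP.algebraMap_adicCompletion_surjective_of_split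
      v p hv (stub_splitPrime F p hsplit v hv).1 (stub_splitPrime F p hsplit v hv).2.1
  exact hF12.det_eq_of_labelledHodgeTateWeights_eq_pair hcrys a b hsurj τ hab σ hσ

end Summit.Langlands.Langlands.Cruxes.EmptyWeightCore.LocalClauseCut

end
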